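import Mathlib
import Summits.ValiantsHypothesis.ValiantsHypothesis.Theorems.FreeSubtorusOrbitDimensionBoundStubAbsorbingSacrificeFinalMatchingRematch
import HarnessLib

/-!
# Route FreeSubtorus — crux `OrbitDimensionBound` (stmt-ValiantsHypothesis-16133), line `affine_multiple`,
# stub 2 `stub_absorbingSacrifice`, step (3): the FINAL MATCHING — off-diagonal pin and the main theorem

Sequel of `…FinalMatchingPrelim.lean` / `…FinalMatchingRematch.lean` (same conventions).

* `concl_of_offDiag` — support position `p₀ = (ι j₀, κ j₁)`, `j₀ ≠ j₁`, no free support: if some re-matching of pair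
  `j₀` (resp. `j₁`) to a free × free pair keeps independence, `p₀` becomes a free-row × matched-column (resp.
  matched-row × free-column) position of the new maximum matching and the mixed-block lemmas finish (SECOND ROUND);
  otherwise every free difference lies in the span of the differences other than `j₀` (resp. `j₁`), so the `j₀`- and
  `j₁`-coefficients of all free rows and columns are constant (`coeff_eq_of_sub_mem_span_ne`): the rigid off-diagonal
  pinned output.
* `finalMatching` — THE CHOICE OF THE FINAL MATCHING: for admissible-row `Λ`, a non-empty support `S` with integer
  semi-invariance `hSI`, and `r + 4 ≤ n`, starting from the maximum independent matching of
  `indepMatching_independent`: `t ≤ r + 1` pairs `(ι, κ)`, `N > 0` with integer expansions of every column of `Λ`, NO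
  free support position, and a pin `p₀ ∈ S` which is a diagonal pair, or a mixed / off-diagonal position carrying the
  constant-coefficient clauses that make its pinned character a power of `∏ d' ∏ e'` (killed on the per-invariant torus
  `T¹`).  This is exactly the input of the relabelling + pinned terminal step of stub 2.

Honest framing: helper plumbing for a registered stub of an OPEN crux on a conditional route; nothing here bears on
`VP ≠ VNP` (NOT proved).  No definitions, no named facts.
-/

-- the mandated summit-side namespace repeats a component by design (single-conjunct summit)
set_option linter.dupNamespace false

namespace Summit.ValiantsHypothesis.ValiantsHypothesis.Theorems.FreeSubtorusOrbitDimensionBound.AbsorbingSacrifice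

open Finset Submodule
open Summit.ValiantsHypothesis.ValiantsHypothesis.Theorems.FreeSubtorusSubtorusCovering
  (indepMatching_span indepMatching_independent)

/-- **Pin at an off-diagonal position of the matched block.**  Maximum independent matching `(ι, κ)`, no free
support, support position `(ι j₀, κ j₁)`, `j₀ ≠ j₁`: re-match pair `j₀` or pair `j₁` into the free block (second
round through the mixed-block lemmas), or the rigid off-diagonal pinned output with constant `j₀`- and
`j₁`-coefficients. [folklore] -/
theorem concl_of_offDiag
    {n r s : ℕ} (Λ : Fin r → (Fin n ⊕ Fin n) → ℤ)
    (hrow : ∀ i, (∑ k, Λ i (Sum.inl k)) = 0) (S : Finset (Fin n × Fin n))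
    (hSI : ∀ x y : Fin n → ℤ, (∀ i, (∑ k, x k * Λ i (Sum.inl k)) + (∑ l, y l * Λ i (Sum.inr l)) = 0) →
      ∀ p₁ ∈ S, ∀ p₂ ∈ S, x p₁.1 + y p₁.2 = x p₂.1 + y p₂.2)
    (ι κ : Fin s ↪ Fin n) (hs : s ≤ r) (hn : s + 4 ≤ n)
    (hw : LinearIndependent ℚ (fun (t : Fin s) (i : Fin r) =>
      ((Λ i (Sum.inl (ι t)) : ℚ) - (Λ i (Sum.inr (κ t)) : ℚ))))
    (hmax : ∀ ι' κ' : Fin (s + 1) ↪ Fin n, ¬ LinearIndependent ℚ (fun (t : Fin (s + 1)) (i : Fin r) =>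
      ((Λ i (Sum.inl (ι' t)) : ℚ) - (Λ i (Sum.inr (κ' t)) : ℚ))))
    (hnofree : ∀ p ∈ S, p.1 ∈ Set.range ι ∨ p.2 ∈ Set.range κ)
    (j₀ j₁ : Fin s) (hne : j₀ ≠ j₁) (hp₀ : (ι j₀, κ j₁) ∈ S) :
    ∃ (t : ℕ) (ι κ : Fin t ↪ Fin n) (N : ℕ) (ar ac : Fin n → Fin t → ℤ) (p₀ : Fin n × Fin n),
      t ≤ r + 1 ∧ 0 < N ∧
      (∀ k i, (N : ℤ) * Λ i (Sum.inl k) = ∑ j, ar k j * (Λ i (Sum.inl (ι j)) - Λ i (Sum.inr (κ j)))) ∧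
      (∀ l i, (N : ℤ) * Λ i (Sum.inr l) = ∑ j, ac l j * (Λ i (Sum.inl (ι j)) - Λ i (Sum.inr (κ j)))) ∧
      (∀ p ∈ S, p.1 ∈ Set.range ι ∨ p.2 ∈ Set.range κ) ∧ p₀ ∈ S ∧
      ((∃ j, p₀ = (ι j, κ j)) ∨
       (∃ (j₀ : Fin t) (l₀ : Fin n) (α : ℤ), p₀ = (ι j₀, l₀) ∧ l₀ ∉ Set.range κ ∧
          (∀ k, k ∉ Set.range ι → ar k j₀ = α) ∧ (∀ l, l ∉ Set.range κ → l ≠ l₀ → ac l j₀ = α) ∧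
          ac l₀ j₀ = α + N) ∨
       (∃ (k₀ : Fin n) (j₀ : Fin t) (α : ℤ), p₀ = (k₀, κ j₀) ∧ k₀ ∉ Set.range ι ∧
          (∀ l, l ∉ Set.range κ → ac l j₀ = α) ∧ (∀ k, k ∉ Set.range ι → k ≠ k₀ → ar k j₀ = α) ∧
          ar k₀ j₀ + N = α) ∨
       (∃ (j₀ j₁ : Fin t) (α₀ α₁ : ℤ), j₀ ≠ j₁ ∧ p₀ = (ι j₀, κ j₁) ∧
          (∀ k, k ∉ Set.range ι → ar k j₀ = α₀) ∧ (∀ l, l ∉ Set.range κ → ac l j₀ = α₀) ∧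
          (∀ k, k ∉ Set.range ι → ar k j₁ = α₁) ∧ (∀ l, l ∉ Set.range κ → ac l j₁ = α₁))) := by
  classical
  let a : Fin n → (Fin r → ℚ) := fun k i => (Λ i (Sum.inl k) : ℚ)
  let b : Fin n → (Fin r → ℚ) := fun l i => (Λ i (Sum.inr l) : ℚ)
  let D : Fin s → (Fin r → ℚ) := fun t => a (ι t) - b (κ t)
  have hw' : LinearIndependent ℚ D := hw
  have hmax' : ∀ ι' κ' : Fin (s + 1) ↪ Fin n, ¬ LinearIndependent ℚ (fun t => a (ι' t) - b (κ' t)) :=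
    fun ι' κ' h => hmax ι' κ' h
  have hspanQ : ∀ k l, a k - b l ∈ Submodule.span ℚ (Set.range D) :=
    indepMatching_span a b ι κ hw' hmax' (by omega)
  obtain ⟨N, ar, ac, hN, har, hac⟩ := intExpansions_of_span Λ hrow (by omega) ι κ (fun k l => hspanQ k l)
  -- rational form of the expansions
  have hcast : ∀ (c : Fin s → ℤ) (z : ℤ) (i : Fin r),
      (N : ℤ) * z = ∑ j, c j * (Λ i (Sum.inl (ι j)) - Λ i (Sum.inr (κ j))) →
      (N : ℚ) * (z : ℚ) = ∑ j, (c j : ℚ) * ((Λ i (Sum.inl (ι j)) : ℚ) - (Λ i (Sum.inr (κ j)) : ℚ)) := by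
    intro c z i h
    have h' : (((N : ℤ) * z : ℤ) : ℚ) = ((∑ j, c j * (Λ i (Sum.inl (ι j)) - Λ i (Sum.inr (κ j))) : ℤ) : ℚ) := by
      rw [h]
    push_cast at h'
    exact h'
  have harQ : ∀ k, (N : ℚ) • a k = ∑ j, (ar k j : ℚ) • D j := by
    intro k
    funext i
    simp only [a, b, D, Pi.smul_apply, Finset.sum_apply, Pi.sub_apply, smul_eq_mul]
    exact hcast (ar k) _ i (har k i)
  have hacQ : ∀ l, (N : ℚ) • b l = ∑ j, (ac l j : ℚ) • D j := by
    intro l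
    funext i
    simp only [a, b, D, Pi.smul_apply, Finset.sum_apply, Pi.sub_apply, smul_eq_mul]
    exact hcast (ac l) _ i (hac l i)
  -- enumerations of the free rows and the free columns by `Fin (n - s)`
  have hcR : Fintype.card {k : Fin n // k ∉ Set.range ι} = n - s := by
    rw [Fintype.card_subtype_compl, Fintype.card_fin, Set.card_range_of_injective ι.injective,
      Fintype.card_fin]
  have hcC : Fintype.card {l : Fin n // l ∉ Set.range κ} = n - s := by
    rw [Fintype.card_subtype_compl, Fintype.card_fin, Set.card_range_of_injective κ.injective,
      Fintype.card_fin]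
  let eR : Fin (n - s) ≃ {k : Fin n // k ∉ Set.range ι} := (Fintype.equivFinOfCardEq hcR).symm
  let eC : Fin (n - s) ≃ {l : Fin n // l ∉ Set.range κ} := (Fintype.equivFinOfCardEq hcC).symm
  let fr : Fin (n - s) → Fin n := fun i => (eR i).1
  let fc : Fin (n - s) → Fin n := fun i => (eC i).1
  have hfr : ∀ i, fr i ∉ Set.range ι := fun i => (eR i).2
  have hfc : ∀ i, fc i ∉ Set.range κ := fun i => (eC i).2
  have hfr_surj : ∀ k, k ∉ Set.range ι → ∃ i, fr i = k := fun k hk =>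
    ⟨eR.symm ⟨k, hk⟩, by simp [fr]⟩
  have hfc_surj : ∀ l, l ∉ Set.range κ → ∃ i, fc i = l := fun l hl =>
    ⟨eC.symm ⟨l, hl⟩, by simp [fc]⟩
  by_cases h1 : ∃ k l : Fin (n - s), LinearIndependent ℚ (Function.update D j₀ (a (fr k) - b (fc l)))
  · -- re-match pair `j₀` to `(fr k, fc l)`: `p₀` becomes free-row × matched-column (`κ' j₁ = κ j₁`)
    obtain ⟨k, l, h2⟩ := h1
    let ι₂ : Fin s ↪ Fin n :=
      ⟨Function.update (⇑ι) j₀ (fr k), update_injective_of_not_mem_range ι j₀ (hfr k)⟩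
    let κ₂ : Fin s ↪ Fin n :=
      ⟨Function.update (⇑κ) j₀ (fc l), update_injective_of_not_mem_range κ j₀ (hfc l)⟩
    have hw₂ : LinearIndependent ℚ (fun (t : Fin s) (i : Fin r) =>
        ((Λ i (Sum.inl (ι₂ t)) : ℚ) - (Λ i (Sum.inr (κ₂ t)) : ℚ))) := by
      have hfun : (fun (t : Fin s) (i : Fin r) => ((Λ i (Sum.inl (ι₂ t)) : ℚ) - (Λ i (Sum.inr (κ₂ t)) : ℚ))) =
          Function.update D j₀ (a (fr k) - b (fc l)) := by
        funext t
        by_cases ht : t = j₀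
        · subst ht
          rw [Function.update_self]
          funext i
          simp [ι₂, κ₂, a, b]
        · rw [Function.update_of_ne ht]
          funext i
          simp [ι₂, κ₂, D, a, b, Function.update_of_ne ht]
      rw [hfun]
      exact h2
    have hκ₂ : κ₂ j₁ = κ j₁ := by simp [κ₂, Function.update_of_ne (Ne.symm hne)]
    by_cases hnf : ∀ p ∈ S, p.1 ∈ Set.range ι₂ ∨ p.2 ∈ Set.range κ₂
    · have hp₀' : (ι j₀, κ₂ j₁) ∈ S := by rw [hκ₂]; exact hp₀
      exact concl_of_freeRow_sacCol Λ hrow S hSI ι₂ κ₂ hs hn hw₂ hmax hnf (ι j₀) j₁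
        (self_not_mem_range_update ι j₀ (hfr k)) hp₀'
    · push Not at hnf
      obtain ⟨p, hp, hpr, hpc⟩ := hnf
      exact concl_of_free_or_diag Λ hrow S hSI ι₂ κ₂ hs (by omega) hw₂ hmax p hp (Or.inl ⟨hpr, hpc⟩)
  by_cases h1' : ∃ k l : Fin (n - s), LinearIndependent ℚ (Function.update D j₁ (a (fr k) - b (fc l)))
  · -- re-match pair `j₁` to `(fr k, fc l)`: `p₀` becomes matched-row × free-column (`ι' j₀ = ι j₀`)
    obtain ⟨k, l, h2⟩ := h1'
    let ι₂ : Fin s ↪ Fin n :=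
      ⟨Function.update (⇑ι) j₁ (fr k), update_injective_of_not_mem_range ι j₁ (hfr k)⟩
    let κ₂ : Fin s ↪ Fin n :=
      ⟨Function.update (⇑κ) j₁ (fc l), update_injective_of_not_mem_range κ j₁ (hfc l)⟩
    have hw₂ : LinearIndependent ℚ (fun (t : Fin s) (i : Fin r) =>
        ((Λ i (Sum.inl (ι₂ t)) : ℚ) - (Λ i (Sum.inr (κ₂ t)) : ℚ))) := by
      have hfun : (fun (t : Fin s) (i : Fin r) => ((Λ i (Sum.inl (ι₂ t)) : ℚ) - (Λ i (Sum.inr (κ₂ t)) : ℚ))) =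
          Function.update D j₁ (a (fr k) - b (fc l)) := by
        funext t
        by_cases ht : t = j₁
        · subst ht
          rw [Function.update_self]
          funext i
          simp [ι₂, κ₂, a, b]
        · rw [Function.update_of_ne ht]
          funext i
          simp [ι₂, κ₂, D, a, b, Function.update_of_ne ht]
      rw [hfun]
      exact h2
    have hι₂ : ι₂ j₀ = ι j₀ := by simp [ι₂, Function.update_of_ne hne]
    by_cases hnf : ∀ p ∈ S, p.1 ∈ Set.range ι₂ ∨ p.2 ∈ Set.range κ₂
    · have hp₀' : (ι₂ j₀, κ j₁) ∈ S := by rw [hι₂]; exact hp₀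
      exact concl_of_sacRow_freeCol Λ hrow S hSI ι₂ κ₂ hs hn hw₂ hmax hnf j₀ (κ j₁)
        (self_not_mem_range_update κ j₁ (hfc l)) hp₀'
    · push Not at hnf
      obtain ⟨p, hp, hpr, hpc⟩ := hnf
      exact concl_of_free_or_diag Λ hrow S hSI ι₂ κ₂ hs (by omega) hw₂ hmax p hp (Or.inl ⟨hpr, hpc⟩)
  -- rigid: every free difference lies in the span of the differences other than `j₀`, and other than `j₁`
  push Not at h1 h1'
  have hmem : ∀ (j' : Fin s), (∀ k l : Fin (n - s), ¬ LinearIndependent ℚ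
      (Function.update D j' (a (fr k) - b (fc l)))) →
      ∀ k l : Fin (n - s), a (fr k) - b (fc l) ∈ Submodule.span ℚ (D '' {j | j ≠ j'}) := by
    intro j' h k l
    by_contra hcon
    exact h k l (linearIndependent_update_of_not_mem_span hw' j' hcon)
  have hconst : ∀ (j' : Fin s), (∀ k l : Fin (n - s), a (fr k) - b (fc l) ∈ Submodule.span ℚ (D '' {j | j ≠ j'})) →
      ∃ α : ℤ, (∀ k, k ∉ Set.range ι → ar k j' = α) ∧ (∀ l, l ∉ Set.range κ → ac l j' = α) := by
    intro j' h
    have heq : ∀ k l : Fin (n - s), ar (fr k) j' = ac (fc l) j' := fun k l =>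
      coeff_eq_of_sub_mem_span_ne hw' j' N (harQ (fr k)) (hacQ (fc l)) (h k l)
    let i₀ : Fin (n - s) := ⟨0, by omega⟩
    refine ⟨ac (fc i₀) j', fun k hk => ?_, fun l hl => ?_⟩
    · obtain ⟨i, rfl⟩ := hfr_surj k hk
      exact heq i i₀
    · obtain ⟨i, rfl⟩ := hfc_surj l hl
      rw [← heq i₀ i, heq i₀ i₀]
  obtain ⟨α₀, hα₀r, hα₀c⟩ := hconst j₀ (hmem j₀ h1)
  obtain ⟨α₁, hα₁r, hα₁c⟩ := hconst j₁ (hmem j₁ h1')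
  exact ⟨s, ι, κ, N, ar, ac, (ι j₀, κ j₁), by omega, hN, har, hac, hnofree, hp₀,
    Or.inr (Or.inr (Or.inr ⟨j₀, j₁, α₀, α₁, hne, rfl, hα₀r, hα₀c, hα₁r, hα₁c⟩))⟩

/-- **THE FINAL MATCHING** (stub 2 of line `affine_multiple`, step (3), combinatorial half).  For a lattice datum
`Λ` with zero row-sums, a non-empty set `S` of positions with the integer semi-invariance `hSI`, and `r + 4 ≤ n`:
there are `t ≤ r + 1` disjoint pairs `(ι j, κ j)`, an `N > 0` with INTEGER expansions of every `N·Λ(·)(inl k)`,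
`N·Λ(·)(inr l)` through the differences of the pairs, NO position of `S` with both coordinates unmatched, and a pin
`p₀ ∈ S` that is a diagonal pair or carries the constant-coefficient clauses of the rigid configuration (mixed or
off-diagonal).  Case tree: maximum independent matching; free support ⇒ extra pair; diagonal support ⇒ done; mixed
support ⇒ `concl_of_sacRow_freeCol` / `concl_of_freeRow_sacCol`; off-diagonal support ⇒ `concl_of_offDiag`.
[folklore] -/
theorem finalMatching
    {n r : ℕ} (Λ : Fin r → (Fin n ⊕ Fin n) → ℤ)
    (hrow : ∀ i, (∑ k, Λ i (Sum.inl k)) = 0) (S : Finset (Fin n × Fin n)) (hS : S.Nonempty)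
    (hSI : ∀ x y : Fin n → ℤ, (∀ i, (∑ k, x k * Λ i (Sum.inl k)) + (∑ l, y l * Λ i (Sum.inr l)) = 0) →
      ∀ p₁ ∈ S, ∀ p₂ ∈ S, x p₁.1 + y p₁.2 = x p₂.1 + y p₂.2)
    (hn : r + 4 ≤ n) :
    ∃ (t : ℕ) (ι κ : Fin t ↪ Fin n) (N : ℕ) (ar ac : Fin n → Fin t → ℤ) (p₀ : Fin n × Fin n),
      t ≤ r + 1 ∧ 0 < N ∧
      (∀ k i, (N : ℤ) * Λ i (Sum.inl k) = ∑ j, ar k j * (Λ i (Sum.inl (ι j)) - Λ i (Sum.inr (κ j)))) ∧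
      (∀ l i, (N : ℤ) * Λ i (Sum.inr l) = ∑ j, ac l j * (Λ i (Sum.inl (ι j)) - Λ i (Sum.inr (κ j)))) ∧
      (∀ p ∈ S, p.1 ∈ Set.range ι ∨ p.2 ∈ Set.range κ) ∧ p₀ ∈ S ∧
      ((∃ j, p₀ = (ι j, κ j)) ∨
       (∃ (j₀ : Fin t) (l₀ : Fin n) (α : ℤ), p₀ = (ι j₀, l₀) ∧ l₀ ∉ Set.range κ ∧
          (∀ k, k ∉ Set.range ι → ar k j₀ = α) ∧ (∀ l, l ∉ Set.range κ → l ≠ l₀ → ac l j₀ = α) ∧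
          ac l₀ j₀ = α + N) ∨
       (∃ (k₀ : Fin n) (j₀ : Fin t) (α : ℤ), p₀ = (k₀, κ j₀) ∧ k₀ ∉ Set.range ι ∧
          (∀ l, l ∉ Set.range κ → ac l j₀ = α) ∧ (∀ k, k ∉ Set.range ι → k ≠ k₀ → ar k j₀ = α) ∧
          ar k₀ j₀ + N = α) ∨
       (∃ (j₀ j₁ : Fin t) (α₀ α₁ : ℤ), j₀ ≠ j₁ ∧ p₀ = (ι j₀, κ j₁) ∧
          (∀ k, k ∉ Set.range ι → ar k j₀ = α₀) ∧ (∀ l, l ∉ Set.range κ → ac l j₀ = α₀) ∧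
          (∀ k, k ∉ Set.range ι → ar k j₁ = α₁) ∧ (∀ l, l ∉ Set.range κ → ac l j₁ = α₁))) := by
  classical
  obtain ⟨s, ι, κ, hs, hw, hmax, -⟩ := indepMatching_independent n r Λ hrow
  -- free support: one extra pair
  by_cases hfree : ∃ p ∈ S, p.1 ∉ Set.range ι ∧ p.2 ∉ Set.range κ
  · obtain ⟨p, hp, hpr, hpc⟩ := hfree
    exact concl_of_free_or_diag Λ hrow S hSI ι κ hs (by omega) hw hmax p hp (Or.inl ⟨hpr, hpc⟩)
  push Not at hfree
  have hnofree : ∀ p ∈ S, p.1 ∈ Set.range ι ∨ p.2 ∈ Set.range κ := fun p hp => by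
    by_cases h : p.1 ∈ Set.range ι
    · exact Or.inl h
    · exact Or.inr (hfree p hp h)
  -- diagonal support: done
  by_cases hdiag : ∃ p ∈ S, ∃ j, p = (ι j, κ j)
  · obtain ⟨p, hp, j, hj⟩ := hdiag
    exact concl_of_free_or_diag Λ hrow S hSI ι κ hs (by omega) hw hmax p hp (Or.inr ⟨j, hj⟩)
  push Not at hdiag
  obtain ⟨p₀, hp₀⟩ := hS
  obtain ⟨u, v⟩ := p₀
  rcases hnofree (u, v) hp₀ with ⟨j₀, hj₀⟩ | ⟨j₁, hj₁⟩
  · -- the row of `p₀` is matched: `u = ι j₀`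
    simp only at hj₀
    subst hj₀
    by_cases hv : v ∈ Set.range κ
    · obtain ⟨j₁, rfl⟩ := hv
      have hne : j₀ ≠ j₁ := fun h => hdiag _ hp₀ j₀ (by rw [h])
      exact concl_of_offDiag Λ hrow S hSI ι κ hs (by omega) hw hmax hnofree j₀ j₁ hne hp₀
    · exact concl_of_sacRow_freeCol Λ hrow S hSI ι κ hs (by omega) hw hmax hnofree j₀ v hv hp₀
  · -- the column of `p₀` is matched: `v = κ j₁`
    simp only at hj₁
    subst hj₁
    by_cases hu : u ∈ Set.range ι
    · obtain ⟨j₀, rfl⟩ := hu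
      have hne : j₀ ≠ j₁ := fun h => hdiag _ hp₀ j₀ (by rw [h])
      exact concl_of_offDiag Λ hrow S hSI ι κ hs (by omega) hw hmax hnofree j₀ j₁ hne hp₀
    · exact concl_of_freeRow_sacCol Λ hrow S hSI ι κ hs (by omega) hw hmax hnofree u j₁ hu hp₀

end Summit.ValiantsHypothesis.ValiantsHypothesis.Theorems.FreeSubtorusOrbitDimensionBound.AbsorbingSacrifice
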